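import Literature.NumberTheory.Transcendental.CurvePeriodsRelationsProofs
import Literature.NumberTheory.Transcendental.CurvePeriodsStokesProofs
import Literature.NumberTheory.Transcendental.CurvePeriodsLogLiftProofs
import Mathlib.Analysis.SpecialFunctions.Complex.Log
import Mathlib.Analysis.SpecialFunctions.ExpDeriv
import Mathlib.Analysis.SpecialFunctions.Trigonometric.Basic
import Mathlib.LinearAlgebra.FiniteDimensional.Basic
import HarnessLib

/-!
# Periods of curve type: closed paths on `𝔾ₘ` are homologous to standard loops via (R5)

Companion of `Literature/NumberTheory/Transcendental/CurvePeriods.lean` (Huber–Wüstholz 2022,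
Thm. 13.3 (2), rendered on explicit period symbols with the elementary relations (R1)–(R5)).
The rendering encodes the relations of relative singular homology by the single generator (R5),
boundaries of `C¹` triangles with algebraic vertices. This file checks, in the first
non-simply-connected case, that (R5) indeed produces the expected homological relations: on the
multiplicative group `𝔾ₘ = {xy = 1} ⊂ 𝔸²` (a smooth affine curve over `ℚ̄`,
`isSmoothAffineCurve_mulGroup`), every CLOSED `C¹` path `γ` based at an algebraic point
`P = (p, p⁻¹)` whose first coordinate admits a `C¹` logarithm `L` with `L(1) − L(0) = 2πi w`
(such an `L` always exists, `CurvePeriodsLogLiftProofs.lean`) gives the same period symbol, up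
to elementary relations, as the **standard loop** `Λ_{p,w}(t) = (p e^{2πiwt}, p⁻¹ e^{−2πiwt})`:

`(𝔾ₘ, ω, γ) = (𝔾ₘ, ω, Λ_{p,w}) + 2ρ₃ − ρ₁ − ρ₂` with `ρ₁, ρ₂, ρ₃` elementary
(`single_loop_eq_single_stdLoop`, `exists_single_loop_eq_single_stdLoop`).

It then relates the standard loops among themselves through functoriality (R4): the base point is
moved to `1` along `(x, y) ↦ (p⁻¹x, py)` (`rel_stdLoop_baseChange`), and the winding number is
reduced to `1` along `(x, y) ↦ (xⁿ, yⁿ)`, resp. `(yⁿ, xⁿ)`, whose pull-backs of `y dx` equal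
`±n · y dx` modulo forms vanishing on `𝔾ₘ` (R1, R2) (`span_stdLoop_intMul`); and it computes the
period `∫_{Λ_{p,w}} y dx = 2πi w` (`period_ydx_stdLoop`). (`y dx` is the class of `dx/x`.)

Finally every polynomial 1-form over `ℚ̄` is reduced on `𝔾ₘ` to its residue,
`ω = α(ω) · y dx + dP + ν` with `ν` vanishing on `𝔾ₘ` (`exists_reduction_form`; (R1), (R2),
(R3)), so that every closed-path symbol is an algebraic multiple of `σ = (𝔾ₘ, y dx, Λ_{1,1})`
modulo relations (`exists_rel_of_mulGroup_closed`), and the (proved) soundness of the relations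
gives **Huber–Wüstholz 13.3 (2) for closed paths on `𝔾ₘ`**
(`huberWustholzCurvePeriods_of_mulGroup_closed`): no transcendence is needed because all these
periods are `ℚ̄`-multiples of the single period `2πi ≠ 0`. (With open paths or the unit symbol
added, the statement would already contain the transcendence of `π`.)

The homotopy is `H(s, t) = (e^{ℓ}, e^{−ℓ})`, `ℓ(s,t) = (1 − s) L(t) + s (L(0) + 2πiwt)`, which is
`C¹` on `ℝ²`, fixes the base point at `t = 0, 1`, and is cut into the two `C¹` triangles
`H(a + b, b)` and `H(a, a + b)` (book §3.3.1: "Up to homotopy such a cycle can be replaced by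
…"; here the homotopy is made explicit and algebraic vertices are kept).

## References

* A. Huber, G. Wüstholz, *Transcendence and Linear Relations of 1-Periods*, Cambridge Tracts in
  Mathematics 227, CUP 2022 [HuberWustholz2022], §3.3.1 (pp. 42–43 of the held text),
  Thm. 13.3 (2) (p. 121); §10.1 (periods of `𝔾ₘ`: `2πi`, p. 96).
-/

noncomputable section

open scoped BigOperators Real
open MvPolynomial Set Complex

namespace Literature.NumberTheory.Transcendental

namespace CurvePeriods

/-! ### Polynomials with algebraic coefficients: closure properties -/

section HasAlgCoeffs

variable {n : ℕ}

/-- [folklore] -/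
theorem HasAlgCoeffs.add {P Q : MvPolynomial (Fin n) ℂ} (hP : HasAlgCoeffs P)
    (hQ : HasAlgCoeffs Q) : HasAlgCoeffs (P + Q) := fun d => by
  rw [coeff_add]; exact (hP d).add (hQ d)

/-- [folklore] -/
theorem HasAlgCoeffs.neg {P : MvPolynomial (Fin n) ℂ} (hP : HasAlgCoeffs P) :
    HasAlgCoeffs (-P) := fun d => by
  rw [coeff_neg]; exact (hP d).neg

/-- [folklore] -/
theorem HasAlgCoeffs.sub {P Q : MvPolynomial (Fin n) ℂ} (hP : HasAlgCoeffs P)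
    (hQ : HasAlgCoeffs Q) : HasAlgCoeffs (P - Q) := fun d => by
  rw [coeff_sub]; exact (hP d).sub (hQ d)

/-- [folklore] -/
theorem HasAlgCoeffs.mul {P Q : MvPolynomial (Fin n) ℂ} (hP : HasAlgCoeffs P)
    (hQ : HasAlgCoeffs Q) : HasAlgCoeffs (P * Q) := fun d => by
  classical
  rw [coeff_mul]
  exact Finset.sum_induction _ (IsAlgebraic ℚ) (fun _ _ ha hb => ha.add hb) isAlgebraic_zero
    fun x _ => (hP x.1).mul (hQ x.2)

/-- [folklore] -/
theorem hasAlgCoeffs_X (i : Fin n) : HasAlgCoeffs (X i : MvPolynomial (Fin n) ℂ) := fun d => by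
  classical
  rw [coeff_X]
  split_ifs
  · exact isAlgebraic_one
  · exact isAlgebraic_zero

end HasAlgCoeffs

/-! ### The multiplicative group `𝔾ₘ = {xy = 1}` as a smooth affine curve -/

/-- Membership in `𝔾ₘ = {z | z₀ z₁ = 1}`. [folklore] -/
theorem mem_points_mulGroup_iff (z : Fin 2 → ℂ) :
    z ∈ (⟨2, 1, ![X 0 * X 1 - 1]⟩ : CurveData).points ↔ z 0 * z 1 = 1 := by
  refine (CurveData.mem_points (Z := ⟨2, 1, ![X 0 * X 1 - 1]⟩) (z := z)).trans ?_
  simp [sub_eq_zero]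

/-- The gradient of `xy − 1` at `z` is `(z₁, z₀)`. [folklore] -/
theorem gradient_mulGroup (z : Fin 2 → ℂ) :
    (⟨2, 1, ![X 0 * X 1 - 1]⟩ : CurveData).gradient 0 z = ![z 1, z 0] := by
  funext i
  simp only [CurveData.gradient, Matrix.cons_val_zero]
  fin_cases i
  · simp [pderiv_X]
  · simp [pderiv_X]

/-- **`𝔾ₘ = {xy = 1} ⊂ 𝔸²` is a smooth affine curve over `ℚ̄`** (book §10.1: the
multiplicative group; Jacobian `(y, x) ≠ 0` on the curve; no isolated points).
[cite: HuberWustholz2022, §10.1 (p. 96)] -/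
theorem isSmoothAffineCurve_mulGroup :
    (⟨2, 1, ![X 0 * X 1 - 1]⟩ : CurveData).IsSmoothAffineCurve where
  algebraic j := by
    fin_cases j
    simpa using ((hasAlgCoeffs_X (n := 2) 0).mul (hasAlgCoeffs_X 1)).sub hasAlgCoeffs_one
  rank_eq z hz := by
    rw [mem_points_mulGroup_iff] at hz
    have hz0 : z 0 ≠ 0 := left_ne_zero_of_mul_eq_one hz
    have hrange : (Set.range fun j : Fin 1 =>
        (⟨2, 1, ![X 0 * X 1 - 1]⟩ : CurveData).gradient j z) = {![z 1, z 0]} := by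
      rw [Set.range_unique]
      simp only [Fin.default_eq_zero, gradient_mulGroup]
    rw [hrange]
    have hv : (![z 1, z 0] : Fin 2 → ℂ) ≠ 0 := by
      intro h
      have := congrFun h 1
      simp only [Matrix.cons_val_one, Pi.zero_apply] at this
      exact hz0 this
    exact finrank_span_singleton hv
  not_isolated z hz := by
    rw [mem_points_mulGroup_iff] at hz
    have hz0 : z 0 ≠ 0 := left_ne_zero_of_mul_eq_one hz
    -- the curve `u ↦ (z₀ eᵘ, z₁ e⁻ᵘ)`, `u ∈ ℝ ∖ {0}`, lies on `𝔾ₘ ∖ {z}` and tends to `z`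
    have hf : Continuous fun u : ℝ => (![z 0 * exp u, z 1 * exp (-u)] : Fin 2 → ℂ) := by
      refine continuous_pi fun i => ?_
      fin_cases i <;> simp <;> fun_prop
    have hf0 : (![z 0 * exp ((0 : ℝ) : ℂ), z 1 * exp (-((0 : ℝ) : ℂ))] : Fin 2 → ℂ) = z := by
      funext i
      fin_cases i <;> simp
    refine mem_closure_of_tendsto (b := nhdsWithin (0 : ℝ) {0}ᶜ)
      (f := fun u : ℝ => (![z 0 * exp u, z 1 * exp (-u)] : Fin 2 → ℂ)) ?_ ?_
    · have h := (hf.tendsto 0).mono_left (nhdsWithin_le_nhds (s := {(0 : ℝ)}ᶜ))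
      rwa [hf0] at h
    · refine eventually_nhdsWithin_of_forall fun u hu => ⟨(mem_points_mulGroup_iff _).2 ?_, ?_⟩
      · simp only [Matrix.cons_val_zero, Matrix.cons_val_one]
        rw [mul_mul_mul_comm, ← exp_add, add_neg_cancel, exp_zero, mul_one, hz]
      · intro h
        have h0 := congrFun h 0
        simp only [Matrix.cons_val_zero] at h0
        have h1 : exp (u : ℂ) = 1 := mul_left_cancel₀ hz0 (h0.trans (mul_one _).symm)
        rw [← ofReal_exp] at h1
        have h2 : Real.exp u = 1 := by exact_mod_cast h1
        exact hu (Real.exp_eq_one_iff u |>.1 h2)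

/-! ### Closed paths on `𝔾ₘ` versus standard loops -/

/-- **A closed `C¹` path on `𝔾ₘ` is (R5)-equivalent to the standard loop with the same base
point and winding number.** Let `γ` be a closed `C¹` path on `𝔾ₘ = {xy = 1}` with algebraic
base point `(p, p⁻¹)`, and let `L` be a `C¹` logarithm of its first coordinate
(`exp (L t) = γ(t)₀` on `[0,1]`, see `CurvePeriodsLogLiftProofs.lean`) with
`L(1) = L(0) + 2πi w`. Then for every polynomial 1-form `ω` over `ℚ̄` the symbol `(𝔾ₘ, ω, γ)`
equals `(𝔾ₘ, ω, Λ) + 2ρ₃ − ρ₁ − ρ₂` where `Λ(t) = (p e^{2πiwt}, p⁻¹e^{−2πiwt})` is the standard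
loop and `ρ₁, ρ₂, ρ₃` are elementary relations (two boundaries of `C¹` triangles cut from the
homotopy `H(s,t) = (e^{ℓ(s,t)}, e^{−ℓ(s,t)})`, `ℓ = (1 − s)L(t) + s(L(0) + 2πiwt)`, and one constant
path). [cite: HuberWustholz2022, §3.3.1 (pp. 42–43)] -/
theorem single_loop_eq_single_stdLoop (ω : Fin 2 → MvPolynomial (Fin 2) ℂ)
    (h : ∀ i, HasAlgCoeffs (ω i)) (γ : CurvePath (⟨2, 1, ![X 0 * X 1 - 1]⟩ : CurveData))
    (L : ℝ → ℂ) (hL : ContDiff ℝ 1 L) (hLx : ∀ t ∈ Icc (0 : ℝ) 1, exp (L t) = γ.toFun t 0)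
    (w : ℤ) (hw : L 1 = L 0 + w * (2 * π * I)) :
    ∃ (Λ : CurvePath (⟨2, 1, ![X 0 * X 1 - 1]⟩ : CurveData)) (ρ₁ ρ₂ ρ₃ : PeriodSymbol →₀ ℂ),
      (∀ t, Λ.toFun t = ![γ.toFun 0 0 * exp (w * (2 * π * I) * t),
        (γ.toFun 0 0)⁻¹ * exp (-(w * (2 * π * I) * t))]) ∧
      IsElementaryRelation ρ₁ ∧ IsElementaryRelation ρ₂ ∧ IsElementaryRelation ρ₃ ∧
      Finsupp.single (⟨⟨2, 1, ![X 0 * X 1 - 1]⟩, isSmoothAffineCurve_mulGroup, ω, h, γ⟩ :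
          PeriodSymbol) (1 : ℂ) =
        Finsupp.single (⟨⟨2, 1, ![X 0 * X 1 - 1]⟩, isSmoothAffineCurve_mulGroup, ω, h, Λ⟩ :
          PeriodSymbol) (1 : ℂ) + (2 • ρ₃ - ρ₁ - ρ₂) := by
  have h0I : (0 : ℝ) ∈ Icc (0 : ℝ) 1 := ⟨le_rfl, zero_le_one⟩
  -- basic facts about `γ`
  have hprod : ∀ t ∈ Icc (0 : ℝ) 1, γ.toFun t 0 * γ.toFun t 1 = 1 := fun t ht =>
    (mem_points_mulGroup_iff _).1 (γ.mem_points t ht)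
  have hy : ∀ t ∈ Icc (0 : ℝ) 1, γ.toFun t 1 = (γ.toFun t 0)⁻¹ := fun t ht =>
    eq_inv_of_mul_eq_one_right (hprod t ht)
  have hL0 : exp (L 0) = γ.toFun 0 0 := hLx 0 h0I
  have hper : exp (L 0 + w * (2 * π * I)) = exp (L 0) := by
    rw [exp_add, exp_int_mul_two_pi_mul_I, mul_one]
  -- the homotopy
  obtain ⟨ℓ, hℓ⟩ : ∃ ℓ : ℝ × ℝ → ℂ, ℓ = fun q =>
      (1 - (q.1 : ℂ)) * L q.2 + (q.1 : ℂ) * (L 0 + w * (2 * π * I) * (q.2 : ℂ)) := ⟨_, rfl⟩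
  have hℓC : ContDiff ℝ 1 ℓ := by
    rw [hℓ]
    have h1 : ContDiff ℝ 1 fun q : ℝ × ℝ => (q.1 : ℂ) := ofRealCLM.contDiff.comp contDiff_fst
    have h2 : ContDiff ℝ 1 fun q : ℝ × ℝ => (q.2 : ℂ) := ofRealCLM.contDiff.comp contDiff_snd
    have h3 : ContDiff ℝ 1 fun q : ℝ × ℝ => L q.2 := hL.comp contDiff_snd
    exact ((contDiff_const.sub h1).mul h3).add
      (h1.mul (contDiff_const.add (contDiff_const.mul h2)))
  obtain ⟨H, hH⟩ : ∃ H : ℝ × ℝ → (Fin 2 → ℂ), H = fun q => ![exp (ℓ q), exp (-ℓ q)] :=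
    ⟨_, rfl⟩
  have hHC : ContDiff ℝ 1 H := by
    rw [hH]
    refine contDiff_pi.2 fun i => ?_
    fin_cases i
    · simpa using hℓC.cexp
    · simpa using hℓC.neg.cexp
  have hHmem : ∀ q, H q ∈ (⟨2, 1, ![X 0 * X 1 - 1]⟩ : CurveData).points := fun q => by
    rw [hH, mem_points_mulGroup_iff]
    simp only [Matrix.cons_val_zero, Matrix.cons_val_one]
    rw [← exp_add, add_neg_cancel, exp_zero]
  -- values of `ℓ` on the edges of the square
  have hℓ_s0 : ∀ s : ℝ, ℓ (s, 0) = L 0 := fun s => by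
    rw [hℓ]; push_cast; ring
  have hℓ_s1 : ∀ s : ℝ, ℓ (s, 1) = L 0 + w * (2 * π * I) := fun s => by
    rw [hℓ]; push_cast; rw [hw]; ring
  have hℓ_1t : ∀ t : ℝ, ℓ (1, t) = L 0 + w * (2 * π * I) * t := fun t => by
    rw [hℓ]; push_cast; ring
  have hℓ_0t : ∀ t : ℝ, ℓ (0, t) = L t := fun t => by
    rw [hℓ]; push_cast; ring
  -- values of `H` on the edges of the square
  have hP0 : (![exp (L 0), exp (-L 0)] : Fin 2 → ℂ) = γ.toFun 0 := by
    funext i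
    fin_cases i
    · simpa using hL0
    · simpa [exp_neg, hL0] using (hy 0 h0I).symm
  have hH_s0 : ∀ s : ℝ, H (s, 0) = γ.toFun 0 := fun s => by
    rw [hH, ← hP0]
    simp only [hℓ_s0]
  have hH_s1 : ∀ s : ℝ, H (s, 1) = γ.toFun 0 := fun s => by
    rw [hH, ← hP0]
    simp only [hℓ_s1]
    rw [exp_neg, exp_neg, hper]
  have hH_0t : ∀ t ∈ Icc (0 : ℝ) 1, H (0, t) = γ.toFun t := fun t ht => by
    rw [hH]
    funext i
    fin_cases i
    · simpa [hℓ_0t] using hLx t ht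
    · simpa [hℓ_0t, exp_neg, hLx t ht] using (hy t ht).symm
  -- the constant path, the standard loop and the diagonal of the homotopy
  let κ : CurvePath (⟨2, 1, ![X 0 * X 1 - 1]⟩ : CurveData) :=
    { toFun := fun _ => γ.toFun 0
      contDiffOn := contDiffOn_const
      mem_points := fun _ _ => γ.mem_points 0 h0I
      algebraic_zero := γ.algebraic_zero
      algebraic_one := γ.algebraic_zero }
  let Λ : CurvePath (⟨2, 1, ![X 0 * X 1 - 1]⟩ : CurveData) :=
    { toFun := fun t => H (1, t)
      contDiffOn := (hHC.comp (contDiff_const.prodMk contDiff_id)).contDiffOn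
      mem_points := fun t _ => hHmem _
      algebraic_zero := fun i => by
        show IsAlgebraic ℚ (H (1, 0) i)
        rw [hH_s0 1]
        exact γ.algebraic_zero i
      algebraic_one := fun i => by
        show IsAlgebraic ℚ (H (1, 1) i)
        rw [hH_s1 1]
        exact γ.algebraic_zero i }
  let δ : CurvePath (⟨2, 1, ![X 0 * X 1 - 1]⟩ : CurveData) :=
    { toFun := fun t => H (t, t)
      contDiffOn := (hHC.comp (contDiff_id.prodMk contDiff_id)).contDiffOn
      mem_points := fun t _ => hHmem _
      algebraic_zero := fun i => by
        show IsAlgebraic ℚ (H (0, 0) i)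
        rw [hH_s0 0]
        exact γ.algebraic_zero i
      algebraic_one := fun i => by
        show IsAlgebraic ℚ (H (1, 1) i)
        rw [hH_s1 1]
        exact γ.algebraic_zero i }
  -- the two triangles cut from the homotopy square
  have hτ₁ : ContDiffOn ℝ 1 (fun q : ℝ × ℝ => H (q.1 + q.2, q.2)) stdTriangle :=
    (hHC.comp ((contDiff_fst.add contDiff_snd).prodMk contDiff_snd)).contDiffOn
  have hτ₂ : ContDiffOn ℝ 1 (fun q : ℝ × ℝ => H (q.1, q.1 + q.2)) stdTriangle :=
    (hHC.comp (contDiff_fst.prodMk (contDiff_fst.add contDiff_snd))).contDiffOn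
  have hb₁ := IsElementaryRelation.boundary _ isSmoothAffineCurve_mulGroup ω h
    (fun q : ℝ × ℝ => H (q.1 + q.2, q.2)) hτ₁ (fun q _ => hHmem _) κ Λ δ
    (fun t _ => by show γ.toFun 0 = H (t + 0, 0); rw [add_zero, hH_s0])
    (fun t _ => by show H (1, t) = H (1 - t + t, t); rw [sub_add_cancel])
    (fun t _ => by show H (t, t) = H (0 + t, t); rw [zero_add])
  have hb₂ := IsElementaryRelation.boundary _ isSmoothAffineCurve_mulGroup ω h
    (fun q : ℝ × ℝ => H (q.1, q.1 + q.2)) hτ₂ (fun q _ => hHmem _) δ κ γ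
    (fun t _ => by show H (t, t) = H (t, t + 0); rw [add_zero])
    (fun t _ => by show γ.toFun 0 = H (1 - t, 1 - t + t); rw [sub_add_cancel, hH_s1])
    (fun t ht => by show γ.toFun t = H (0, 0 + t); rw [zero_add, hH_0t t ht])
  have hκ : IsElementaryRelation (Finsupp.single
      (⟨⟨2, 1, ![X 0 * X 1 - 1]⟩, isSmoothAffineCurve_mulGroup, ω, h, κ⟩ : PeriodSymbol) 1) :=
    isElementaryRelation_single_of_const isSmoothAffineCurve_mulGroup ω h κ (γ.toFun 0)
      fun _ _ => rfl
  refine ⟨Λ, _, _, _, fun t => ?_, hb₁, hb₂, hκ, ?_⟩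
  · show H (1, t) = _
    rw [hH]
    simp only [hℓ_1t]
    funext i
    fin_cases i
    · simp [exp_add, hL0]
    · simp [exp_add, exp_neg, hL0, mul_comm]
  · abel

/-! ### The `ℚ̄`-span of the elementary relations: closure properties

The conclusion format of `HuberWustholzCurvePeriods` is membership in the `ℚ̄`-span of the
elementary relations, written out as `∃ k ρ a, …`; we record its closure under `0`, the
generators, sums and algebraic scalars. -/

section Span

/-- `0` is in the span. [folklore] -/
theorem span_zero : ∃ (k : ℕ) (ρ : Fin k → (PeriodSymbol →₀ ℂ)) (a : Fin k → ℂ),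
    (∀ l, IsElementaryRelation (ρ l)) ∧ (∀ l, IsAlgebraic ℚ (a l)) ∧
      (0 : PeriodSymbol →₀ ℂ) = ∑ l, a l • ρ l :=
  ⟨0, Fin.elim0, Fin.elim0, fun l => l.elim0, fun l => l.elim0, by simp⟩

/-- An elementary relation is in the span. [folklore] -/
theorem span_of_rel {ρ₀ : PeriodSymbol →₀ ℂ} (h : IsElementaryRelation ρ₀) :
    ∃ (k : ℕ) (ρ : Fin k → (PeriodSymbol →₀ ℂ)) (a : Fin k → ℂ),
      (∀ l, IsElementaryRelation (ρ l)) ∧ (∀ l, IsAlgebraic ℚ (a l)) ∧ ρ₀ = ∑ l, a l • ρ l :=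
  ⟨1, fun _ => ρ₀, fun _ => 1, fun _ => h, fun _ => isAlgebraic_one, by simp⟩

/-- The span is closed under sums. [folklore] -/
theorem span_add {c₁ c₂ : PeriodSymbol →₀ ℂ}
    (h₁ : ∃ (k : ℕ) (ρ : Fin k → (PeriodSymbol →₀ ℂ)) (a : Fin k → ℂ),
      (∀ l, IsElementaryRelation (ρ l)) ∧ (∀ l, IsAlgebraic ℚ (a l)) ∧ c₁ = ∑ l, a l • ρ l)
    (h₂ : ∃ (k : ℕ) (ρ : Fin k → (PeriodSymbol →₀ ℂ)) (a : Fin k → ℂ),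
      (∀ l, IsElementaryRelation (ρ l)) ∧ (∀ l, IsAlgebraic ℚ (a l)) ∧ c₂ = ∑ l, a l • ρ l) :
    ∃ (k : ℕ) (ρ : Fin k → (PeriodSymbol →₀ ℂ)) (a : Fin k → ℂ),
      (∀ l, IsElementaryRelation (ρ l)) ∧ (∀ l, IsAlgebraic ℚ (a l)) ∧
        c₁ + c₂ = ∑ l, a l • ρ l := by
  obtain ⟨k₁, ρ₁, a₁, hρ₁, ha₁, rfl⟩ := h₁
  obtain ⟨k₂, ρ₂, a₂, hρ₂, ha₂, rfl⟩ := h₂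
  refine ⟨k₁ + k₂, Fin.append ρ₁ ρ₂, Fin.append a₁ a₂, fun l => ?_, fun l => ?_, ?_⟩
  · refine Fin.addCases (motive := fun l => IsElementaryRelation (Fin.append ρ₁ ρ₂ l))
      (fun i => ?_) (fun i => ?_) l
    · simpa using hρ₁ i
    · simpa using hρ₂ i
  · refine Fin.addCases (motive := fun l => IsAlgebraic ℚ (Fin.append a₁ a₂ l))
      (fun i => ?_) (fun i => ?_) l
    · simpa using ha₁ i
    · simpa using ha₂ i
  · rw [Fin.sum_univ_add]
    simp

/-- The span is closed under algebraic scalars. [folklore] -/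
theorem span_smul {c : PeriodSymbol →₀ ℂ} {b : ℂ} (hb : IsAlgebraic ℚ b)
    (h : ∃ (k : ℕ) (ρ : Fin k → (PeriodSymbol →₀ ℂ)) (a : Fin k → ℂ),
      (∀ l, IsElementaryRelation (ρ l)) ∧ (∀ l, IsAlgebraic ℚ (a l)) ∧ c = ∑ l, a l • ρ l) :
    ∃ (k : ℕ) (ρ : Fin k → (PeriodSymbol →₀ ℂ)) (a : Fin k → ℂ),
      (∀ l, IsElementaryRelation (ρ l)) ∧ (∀ l, IsAlgebraic ℚ (a l)) ∧
        b • c = ∑ l, a l • ρ l := by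
  obtain ⟨k, ρ, a, hρ, ha, rfl⟩ := h
  refine ⟨k, ρ, fun l => b * a l, hρ, fun l => hb.mul (ha l), ?_⟩
  rw [Finset.smul_sum]
  simp [smul_smul]

/-- The span is closed under differences. [folklore] -/
theorem span_sub {c₁ c₂ : PeriodSymbol →₀ ℂ}
    (h₁ : ∃ (k : ℕ) (ρ : Fin k → (PeriodSymbol →₀ ℂ)) (a : Fin k → ℂ),
      (∀ l, IsElementaryRelation (ρ l)) ∧ (∀ l, IsAlgebraic ℚ (a l)) ∧ c₁ = ∑ l, a l • ρ l)
    (h₂ : ∃ (k : ℕ) (ρ : Fin k → (PeriodSymbol →₀ ℂ)) (a : Fin k → ℂ),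
      (∀ l, IsElementaryRelation (ρ l)) ∧ (∀ l, IsAlgebraic ℚ (a l)) ∧ c₂ = ∑ l, a l • ρ l) :
    ∃ (k : ℕ) (ρ : Fin k → (PeriodSymbol →₀ ℂ)) (a : Fin k → ℂ),
      (∀ l, IsElementaryRelation (ρ l)) ∧ (∀ l, IsAlgebraic ℚ (a l)) ∧
        c₁ - c₂ = ∑ l, a l • ρ l := by
  have h := span_add h₁ (span_smul (isAlgebraic_one.neg) h₂)
  simpa [sub_eq_add_neg] using h

end Span

/-! ### Standard loops on `𝔾ₘ` -/

/-- Two period symbols with the same curve, path and form are equal, whatever the proofs.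
[folklore] -/
theorem PeriodSymbol.mk_eq_mk {Z : CurveData} (hZ : Z.IsSmoothAffineCurve)
    {ω₁ ω₂ : Fin Z.n → MvPolynomial (Fin Z.n) ℂ} (h₁ : ∀ i, HasAlgCoeffs (ω₁ i))
    (h₂ : ∀ i, HasAlgCoeffs (ω₂ i)) (γ : CurvePath Z) (hω : ω₁ = ω₂) :
    (⟨Z, hZ, ω₁, h₁, γ⟩ : PeriodSymbol) = ⟨Z, hZ, ω₂, h₂, γ⟩ := by
  subst hω
  rfl

/-- The form `y dx` on `𝔾ₘ ⊂ 𝔸²` has algebraic coefficients. [folklore] -/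
theorem hasAlgCoeffs_ydx : ∀ i, HasAlgCoeffs ((![X 1, 0] : Fin 2 → MvPolynomial (Fin 2) ℂ) i) := by
  intro i
  fin_cases i
  · simpa using hasAlgCoeffs_X (n := 2) 1
  · simpa using (hasAlgCoeffs_zero (n := 2))

/-- **Standard loops exist as `C¹` paths on `𝔾ₘ`**: for algebraic `p ≠ 0` and `w ∈ ℤ`,
`Λ_{p,w}(t) = (p e^{2πiwt}, p⁻¹ e^{−2πiwt})` is a closed `C¹` path on `𝔾ₘ` based at the algebraic
point `(p, p⁻¹)`. [folklore] -/
theorem exists_stdLoop {p : ℂ} (hp : IsAlgebraic ℚ p) (hp0 : p ≠ 0) (w : ℤ) :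
    ∃ Λ : CurvePath (⟨2, 1, ![X 0 * X 1 - 1]⟩ : CurveData), ∀ t, Λ.toFun t =
      ![p * exp (w * (2 * π * I) * t), p⁻¹ * exp (-(w * (2 * π * I) * t))] := by
  have h1 : ContDiff ℝ 1 fun t : ℝ => (w : ℂ) * (2 * π * I) * (t : ℂ) :=
    contDiff_const.mul ofRealCLM.contDiff
  refine ⟨{ toFun := fun t => ![p * exp (w * (2 * π * I) * t), p⁻¹ * exp (-(w * (2 * π * I) * t))]
            contDiffOn := ?_
            mem_points := ?_
            algebraic_zero := ?_
            algebraic_one := ?_ }, fun t => rfl⟩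
  · refine ContDiff.contDiffOn (contDiff_pi.2 fun i => ?_)
    fin_cases i
    · simpa using contDiff_const.mul h1.cexp
    · simpa using contDiff_const.mul h1.neg.cexp
  · intro t _
    rw [mem_points_mulGroup_iff]
    simp only [Matrix.cons_val_zero, Matrix.cons_val_one]
    rw [mul_mul_mul_comm, mul_inv_cancel₀ hp0, ← exp_add, add_neg_cancel, exp_zero, mul_one]
  · intro i
    fin_cases i
    · simpa using hp
    · simpa using hp.inv
  · intro i
    fin_cases i
    · simpa [exp_int_mul_two_pi_mul_I] using hp
    · simpa [exp_neg, exp_int_mul_two_pi_mul_I] using hp.inv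

/-- **The period of `y dx` (the class of `dx/x`) along the standard loop `Λ_{p,w}` is `2πi · w`**
(book §10.1: `2πi` is the period of `𝔾ₘ`). [cite: HuberWustholz2022, §10.1 (p. 96)] -/
theorem period_ydx_stdLoop {p : ℂ} (hp0 : p ≠ 0) (w : ℤ)
    (Λ : CurvePath (⟨2, 1, ![X 0 * X 1 - 1]⟩ : CurveData))
    (hΛ : ∀ t, Λ.toFun t = ![p * exp (w * (2 * π * I) * t), p⁻¹ * exp (-(w * (2 * π * I) * t))]) :
    (⟨⟨2, 1, ![X 0 * X 1 - 1]⟩, isSmoothAffineCurve_mulGroup, ![X 1, 0], hasAlgCoeffs_ydx, Λ⟩ :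
      PeriodSymbol).period = w * (2 * π * I) := by
  have hd : ∀ t : ℝ, HasDerivAt (fun s : ℝ => exp ((w : ℂ) * (2 * π * I) * (s : ℂ)))
      (exp ((w : ℂ) * (2 * π * I) * (t : ℂ)) * ((w : ℂ) * (2 * π * I))) t := fun t => by
    have h := (((hasDerivAt_id (t : ℂ)).const_mul ((w : ℂ) * (2 * π * I))).cexp).comp_ofReal
    simpa using h
  have hd' : ∀ t : ℝ, HasDerivAt (fun s : ℝ => exp (-((w : ℂ) * (2 * π * I) * (s : ℂ))))
      (exp (-((w : ℂ) * (2 * π * I) * (t : ℂ))) * -((w : ℂ) * (2 * π * I))) t := fun t => by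
    have h := (((hasDerivAt_id (t : ℂ)).const_mul ((w : ℂ) * (2 * π * I))).neg.cexp).comp_ofReal
    simpa using h
  rw [PeriodSymbol.period_eq_of_hasDerivAt
    ⟨⟨2, 1, ![X 0 * X 1 - 1]⟩, isSmoothAffineCurve_mulGroup, ![X 1, 0], hasAlgCoeffs_ydx, Λ⟩
    (fun t : ℝ => ![p * exp (w * (2 * π * I) * t), p⁻¹ * exp (-(w * (2 * π * I) * t))])
    (fun t : ℝ => ![p * (exp ((w : ℂ) * (2 * π * I) * (t : ℂ)) * ((w : ℂ) * (2 * π * I))),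
      p⁻¹ * (exp (-((w : ℂ) * (2 * π * I) * (t : ℂ))) * -((w : ℂ) * (2 * π * I)))])
    (fun t _ => hΛ t) (fun t _ i => ?_)]
  · have hconst : ∀ t : ℝ, (∑ i : Fin 2,
        eval (![p * exp (w * (2 * π * I) * t), p⁻¹ * exp (-(w * (2 * π * I) * t))] : Fin 2 → ℂ)
          ((![X 1, 0] : Fin 2 → MvPolynomial (Fin 2) ℂ) i) *
        (![p * (exp ((w : ℂ) * (2 * π * I) * (t : ℂ)) * ((w : ℂ) * (2 * π * I))),
          p⁻¹ * (exp (-((w : ℂ) * (2 * π * I) * (t : ℂ))) * -((w : ℂ) * (2 * π * I)))] :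
            Fin 2 → ℂ) i) = w * (2 * π * I) := by
      intro t
      rw [Fin.sum_univ_two]
      simp only [Matrix.cons_val_zero, Matrix.cons_val_one, eval_X, map_zero, zero_mul, add_zero]
      rw [show p⁻¹ * exp (-((w : ℂ) * (2 * π * I) * (t : ℂ))) *
          (p * (exp ((w : ℂ) * (2 * π * I) * (t : ℂ)) * ((w : ℂ) * (2 * π * I)))) =
          (p⁻¹ * p) * (exp (-((w : ℂ) * (2 * π * I) * (t : ℂ))) *
            exp ((w : ℂ) * (2 * π * I) * (t : ℂ))) * ((w : ℂ) * (2 * π * I)) by ring,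
        inv_mul_cancel₀ hp0, ← exp_add, neg_add_cancel, exp_zero]
      ring
    simp_rw [hconst]
    simp
  · fin_cases i
    · exact (hd t).const_mul p
    · exact (hd' t).const_mul p⁻¹

/-- Scalar multiples by algebraic numbers preserve algebraic coefficients. [folklore] -/
theorem HasAlgCoeffs.smul {n : ℕ} {P : MvPolynomial (Fin n) ℂ} {a : ℂ} (ha : IsAlgebraic ℚ a)
    (hP : HasAlgCoeffs P) : HasAlgCoeffs (a • P) := fun d => by
  rw [coeff_smul, smul_eq_mul]; exact ha.mul (hP d)

/-- Powers preserve algebraic coefficients. [folklore] -/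
theorem HasAlgCoeffs.pow {n : ℕ} {P : MvPolynomial (Fin n) ℂ} (hP : HasAlgCoeffs P) :
    ∀ k : ℕ, HasAlgCoeffs (P ^ k)
  | 0 => by simpa using (hasAlgCoeffs_one (n := n))
  | k + 1 => by rw [pow_succ]; exact (hP.pow k).mul hP

/-- The tangent space of `𝔾ₘ` at `z`: `z₁ v₀ + z₀ v₁ = 0`. [folklore] -/
theorem mem_tangentSpace_mulGroup_iff (z v : Fin 2 → ℂ) :
    v ∈ (⟨2, 1, ![X 0 * X 1 - 1]⟩ : CurveData).tangentSpace z ↔ z 1 * v 0 + z 0 * v 1 = 0 := by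
  simp only [CurveData.tangentSpace, mem_setOf_eq, Fin.forall_fin_one, Fin.sum_univ_two]
  rw [show (0 : Fin (⟨2, 1, ![X 0 * X 1 - 1]⟩ : CurveData).m) = (0 : Fin 1) from rfl,
    gradient_mulGroup]
  simp

/-- **Change of base point (R4)**: along `f(x, y) = (p⁻¹x, py)`, which maps `𝔾ₘ` to itself,
pulls `y dx` back to itself and maps `Λ_{p,w}` to `Λ_{1,w}`, the symbols `(𝔾ₘ, y dx, Λ_{p,w})`
and `(𝔾ₘ, y dx, Λ_{1,w})` differ by an elementary relation. [folklore] -/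
theorem rel_stdLoop_baseChange {p : ℂ} (hp : IsAlgebraic ℚ p) (hp0 : p ≠ 0) (w : ℤ)
    (Λ Λ₁ : CurvePath (⟨2, 1, ![X 0 * X 1 - 1]⟩ : CurveData))
    (hΛ : ∀ t, Λ.toFun t = ![p * exp (w * (2 * π * I) * t), p⁻¹ * exp (-(w * (2 * π * I) * t))])
    (hΛ₁ : ∀ t, Λ₁.toFun t =
      ![1 * exp (w * (2 * π * I) * t), 1⁻¹ * exp (-(w * (2 * π * I) * t))]) :
    IsElementaryRelation
      (Finsupp.single (⟨⟨2, 1, ![X 0 * X 1 - 1]⟩, isSmoothAffineCurve_mulGroup, ![X 1, 0],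
          hasAlgCoeffs_ydx, Λ⟩ : PeriodSymbol) 1 -
        Finsupp.single (⟨⟨2, 1, ![X 0 * X 1 - 1]⟩, isSmoothAffineCurve_mulGroup, ![X 1, 0],
          hasAlgCoeffs_ydx, Λ₁⟩ : PeriodSymbol) 1) := by
  have hf : ∀ j, HasAlgCoeffs ((![C p⁻¹ * X 0, C p * X 1] : Fin 2 → MvPolynomial (Fin 2) ℂ) j) := by
    intro j
    fin_cases j
    · simpa using (hasAlgCoeffs_C hp.inv).mul (hasAlgCoeffs_X (n := 2) 0)
    · simpa using (hasAlgCoeffs_C hp).mul (hasAlgCoeffs_X (n := 2) 1)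
  have hfZ : ∀ z ∈ (⟨2, 1, ![X 0 * X 1 - 1]⟩ : CurveData).points,
      (fun j => eval z ((![C p⁻¹ * X 0, C p * X 1] : Fin 2 → MvPolynomial (Fin 2) ℂ) j)) ∈
        (⟨2, 1, ![X 0 * X 1 - 1]⟩ : CurveData).points := by
    intro z hz
    rw [mem_points_mulGroup_iff] at hz ⊢
    simp only [Matrix.cons_val_zero, Matrix.cons_val_one, map_mul, eval_C, eval_X]
    calc p⁻¹ * z 0 * (p * z 1) = (p⁻¹ * p) * (z 0 * z 1) := by ring
      _ = 1 := by rw [inv_mul_cancel₀ hp0, hz, one_mul]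
  have hpull : formPullback (![C p⁻¹ * X 0, C p * X 1] : Fin 2 → MvPolynomial (Fin 2) ℂ)
      ![X 1, 0] = ![X 1, 0] := by
    funext i
    fin_cases i
    · simp only [formPullback, Fin.sum_univ_two, Matrix.cons_val_zero, Matrix.cons_val_one,
        bind₁_X_right, map_zero, zero_mul, add_zero, Fin.zero_eta, pderiv_mul, pderiv_C,
        pderiv_X_self, mul_one]
      rw [zero_add, mul_comm (C p) (X 1), mul_assoc, ← C_mul, mul_inv_cancel₀ hp0, C_1, mul_one]
    · simp [formPullback, Fin.sum_univ_two, pderiv_X]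
  have key := IsElementaryRelation.pushforward _ _ isSmoothAffineCurve_mulGroup
    isSmoothAffineCurve_mulGroup (![C p⁻¹ * X 0, C p * X 1]) hf hfZ ![X 1, 0] hasAlgCoeffs_ydx
    (formPullback (![C p⁻¹ * X 0, C p * X 1] : Fin 2 → MvPolynomial (Fin 2) ℂ) ![X 1, 0])
    (fun i => by rw [hpull]; exact hasAlgCoeffs_ydx i) rfl Λ Λ₁ (fun t _ => by
      rw [hΛ₁, hΛ]
      funext j
      fin_cases j
      · simp [hp0]
      · simp [hp0])
  rwa [PeriodSymbol.mk_eq_mk isSmoothAffineCurve_mulGroup _ hasAlgCoeffs_ydx Λ hpull] at key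

/-- Natural-number constants have algebraic coefficients. [folklore] -/
theorem hasAlgCoeffs_natCast {m : ℕ} (n : ℕ) : HasAlgCoeffs ((n : MvPolynomial (Fin m) ℂ)) := by
  rw [← map_natCast (C : ℂ →+* MvPolynomial (Fin m) ℂ) n]
  exact hasAlgCoeffs_C (isAlgebraic_nat n)

/-- **Change of winding number (R4, R1, R2), non-negative case**: along `g(x, y) = (xⁿ, yⁿ)`,
`g^*(y dx) = n (xy)^{n-1} · y dx ≡ n · y dx` modulo a form vanishing on `𝔾ₘ`, and
`g ∘ Λ_{1,1} = Λ_{1,n}`; hence `(𝔾ₘ, y dx, Λ_{1,n}) − n · (𝔾ₘ, y dx, Λ_{1,1})` lies in the `ℚ̄`-span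
of the elementary relations. [folklore] -/
theorem span_stdLoop_natMul (n : ℕ) (Λ₁ Λn : CurvePath (⟨2, 1, ![X 0 * X 1 - 1]⟩ : CurveData))
    (hΛ₁ : ∀ t, Λ₁.toFun t = ![1 * exp (((1 : ℤ) : ℂ) * (2 * π * I) * t),
      1⁻¹ * exp (-(((1 : ℤ) : ℂ) * (2 * π * I) * t))])
    (hΛn : ∀ t, Λn.toFun t = ![1 * exp (((n : ℤ) : ℂ) * (2 * π * I) * t),
      1⁻¹ * exp (-(((n : ℤ) : ℂ) * (2 * π * I) * t))]) :
    ∃ (k : ℕ) (ρ : Fin k → (PeriodSymbol →₀ ℂ)) (a : Fin k → ℂ),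
      (∀ l, IsElementaryRelation (ρ l)) ∧ (∀ l, IsAlgebraic ℚ (a l)) ∧
        Finsupp.single (⟨⟨2, 1, ![X 0 * X 1 - 1]⟩, isSmoothAffineCurve_mulGroup, ![X 1, 0],
            hasAlgCoeffs_ydx, Λn⟩ : PeriodSymbol) (1 : ℂ) -
          ((n : ℤ) : ℂ) • Finsupp.single (⟨⟨2, 1, ![X 0 * X 1 - 1]⟩, isSmoothAffineCurve_mulGroup,
            ![X 1, 0], hasAlgCoeffs_ydx, Λ₁⟩ : PeriodSymbol) (1 : ℂ) = ∑ l, a l • ρ l := by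
  have hG := isSmoothAffineCurve_mulGroup
  -- the map `g = (xⁿ, yⁿ)`
  have hg : ∀ j, HasAlgCoeffs ((![X 0 ^ n, X 1 ^ n] : Fin 2 → MvPolynomial (Fin 2) ℂ) j) := by
    intro j
    fin_cases j
    · simpa using (hasAlgCoeffs_X (n := 2) 0).pow n
    · simpa using (hasAlgCoeffs_X (n := 2) 1).pow n
  have hgZ : ∀ z ∈ (⟨2, 1, ![X 0 * X 1 - 1]⟩ : CurveData).points,
      (fun j => eval z ((![X 0 ^ n, X 1 ^ n] : Fin 2 → MvPolynomial (Fin 2) ℂ) j)) ∈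
        (⟨2, 1, ![X 0 * X 1 - 1]⟩ : CurveData).points := by
    intro z hz
    rw [mem_points_mulGroup_iff] at hz ⊢
    simp only [Matrix.cons_val_zero, Matrix.cons_val_one, map_pow, eval_X]
    rw [← mul_pow, hz, one_pow]
  -- its pull-back of `y dx`
  have hpull : formPullback (![X 0 ^ n, X 1 ^ n] : Fin 2 → MvPolynomial (Fin 2) ℂ) ![X 1, 0] =
      ![X 1 ^ n * ((n : MvPolynomial (Fin 2) ℂ) * X 0 ^ (n - 1)), 0] := by
    funext i
    fin_cases i
    · simp [formPullback, Fin.sum_univ_two]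
    · simp [formPullback, Fin.sum_univ_two]
  have hωalg : ∀ i, HasAlgCoeffs (formPullback (![X 0 ^ n, X 1 ^ n] :
      Fin 2 → MvPolynomial (Fin 2) ℂ) ![X 1, 0] i) := by
    intro i
    rw [hpull]
    fin_cases i
    · simpa using ((hasAlgCoeffs_X (n := 2) 1).pow n).mul
        ((hasAlgCoeffs_natCast n).mul ((hasAlgCoeffs_X (n := 2) 0).pow (n - 1)))
    · simpa using (hasAlgCoeffs_zero (n := 2))
  have hnalg : ∀ i, HasAlgCoeffs (((((n : ℤ) : ℂ)) • (![X 1, 0] :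
      Fin 2 → MvPolynomial (Fin 2) ℂ)) i) :=
    fun i => (hasAlgCoeffs_ydx i).smul (by exact_mod_cast isAlgebraic_int (R := ℚ) (A := ℂ) n)
  have hνalg : ∀ i, HasAlgCoeffs ((formPullback (![X 0 ^ n, X 1 ^ n] :
      Fin 2 → MvPolynomial (Fin 2) ℂ) ![X 1, 0] - ((n : ℤ) : ℂ) • (![X 1, 0] :
      Fin 2 → MvPolynomial (Fin 2) ℂ)) i) := fun i => (hωalg i).sub (hnalg i)
  have hνvan : VanishesOn ⟨2, 1, ![X 0 * X 1 - 1]⟩ (formPullback (![X 0 ^ n, X 1 ^ n] :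
      Fin 2 → MvPolynomial (Fin 2) ℂ) ![X 1, 0] - ((n : ℤ) : ℂ) • (![X 1, 0] :
      Fin 2 → MvPolynomial (Fin 2) ℂ)) := by
    intro z hz v _
    rw [mem_points_mulGroup_iff] at hz
    rw [hpull, Fin.sum_univ_two]
    simp only [Pi.sub_apply, Pi.smul_apply, Matrix.cons_val_zero, Matrix.cons_val_one, map_sub,
      map_mul, map_pow, eval_X, map_natCast, smul_eq_C_mul, map_zero,
      mul_zero, sub_zero, zero_mul, add_zero, Int.cast_natCast]
    rcases n with _ | k
    · simp
    · have hk : z 1 ^ (k + 1) * (((k + 1 : ℕ) : ℂ) * z 0 ^ (k + 1 - 1)) =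
          ((k + 1 : ℕ) : ℂ) * z 1 * (z 0 * z 1) ^ k := by
        rw [Nat.add_sub_cancel]; ring
      rw [hk, hz, one_pow, mul_one, sub_self, zero_mul]
  -- the four elementary relations
  have key₁ := IsElementaryRelation.pushforward _ _ hG hG (![X 0 ^ n, X 1 ^ n]) hg hgZ ![X 1, 0]
    hasAlgCoeffs_ydx _ hωalg rfl Λ₁ Λn (fun t _ => by
      rw [hΛn, hΛ₁]
      funext j
      fin_cases j
      · simp only [one_mul, Int.cast_one, Int.cast_natCast]
        simp
        rw [← exp_nat_mul]
        congr 1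
        ring
      · simp only [one_mul, inv_one, Int.cast_one, Int.cast_natCast]
        simp
        rw [← exp_nat_mul]
        congr 1
        ring)
  have key₂ := IsElementaryRelation.add _ hG Λ₁ _ _ _ hωalg hnalg hνalg
    (add_sub_cancel (((n : ℤ) : ℂ) • (![X 1, 0] : Fin 2 → MvPolynomial (Fin 2) ℂ))
      (formPullback (![X 0 ^ n, X 1 ^ n] : Fin 2 → MvPolynomial (Fin 2) ℂ) ![X 1, 0])).symm
  have key₃ := IsElementaryRelation.smul _ hG Λ₁ ((n : ℤ) : ℂ)
    (by exact_mod_cast isAlgebraic_int (R := ℚ) (A := ℂ) n) ![X 1, 0] _ hasAlgCoeffs_ydx hnalg rfl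
  have key₄ := IsElementaryRelation.vanish _ hG Λ₁ _ hνalg hνvan
  obtain ⟨k, ρ, a, hρ, ha, he⟩ := span_sub (span_add (span_add (span_of_rel key₂)
    (span_of_rel key₃)) (span_of_rel key₄)) (span_of_rel key₁)
  exact ⟨k, ρ, a, hρ, ha, by rw [← he]; abel⟩

/-- **Change of winding number, negative case**: along `h(x, y) = (yⁿ, xⁿ)` (inversion composed
with the `n`-th power), `h^*(y dx) = n xⁿ yⁿ⁻¹ dy ≡ −n · y dx` modulo a form vanishing on the
tangent lines of `𝔾ₘ` (`y dx + x dy = 0` there), and `h ∘ Λ_{1,1} = Λ_{1,−n}`.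
[folklore] -/
theorem span_stdLoop_negMul (n : ℕ) (Λ₁ Λm : CurvePath (⟨2, 1, ![X 0 * X 1 - 1]⟩ : CurveData))
    (hΛ₁ : ∀ t, Λ₁.toFun t = ![1 * exp (((1 : ℤ) : ℂ) * (2 * π * I) * t),
      1⁻¹ * exp (-(((1 : ℤ) : ℂ) * (2 * π * I) * t))])
    (hΛm : ∀ t, Λm.toFun t = ![1 * exp (((-(n : ℤ) : ℤ) : ℂ) * (2 * π * I) * t),
      1⁻¹ * exp (-(((-(n : ℤ) : ℤ) : ℂ) * (2 * π * I) * t))]) :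
    ∃ (k : ℕ) (ρ : Fin k → (PeriodSymbol →₀ ℂ)) (a : Fin k → ℂ),
      (∀ l, IsElementaryRelation (ρ l)) ∧ (∀ l, IsAlgebraic ℚ (a l)) ∧
        Finsupp.single (⟨⟨2, 1, ![X 0 * X 1 - 1]⟩, isSmoothAffineCurve_mulGroup, ![X 1, 0],
            hasAlgCoeffs_ydx, Λm⟩ : PeriodSymbol) (1 : ℂ) -
          ((-(n : ℤ) : ℤ) : ℂ) • Finsupp.single (⟨⟨2, 1, ![X 0 * X 1 - 1]⟩,
            isSmoothAffineCurve_mulGroup, ![X 1, 0], hasAlgCoeffs_ydx, Λ₁⟩ : PeriodSymbol) (1 : ℂ) =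
          ∑ l, a l • ρ l := by
  have hG := isSmoothAffineCurve_mulGroup
  have halg_n : IsAlgebraic ℚ (((-(n : ℤ) : ℤ) : ℂ)) := by
    exact_mod_cast isAlgebraic_int (R := ℚ) (A := ℂ) (-(n : ℤ))
  -- the map `h = (yⁿ, xⁿ)`
  have hh : ∀ j, HasAlgCoeffs ((![X 1 ^ n, X 0 ^ n] : Fin 2 → MvPolynomial (Fin 2) ℂ) j) := by
    intro j
    fin_cases j
    · simpa using (hasAlgCoeffs_X (n := 2) 1).pow n
    · simpa using (hasAlgCoeffs_X (n := 2) 0).pow n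
  have hhZ : ∀ z ∈ (⟨2, 1, ![X 0 * X 1 - 1]⟩ : CurveData).points,
      (fun j => eval z ((![X 1 ^ n, X 0 ^ n] : Fin 2 → MvPolynomial (Fin 2) ℂ) j)) ∈
        (⟨2, 1, ![X 0 * X 1 - 1]⟩ : CurveData).points := by
    intro z hz
    rw [mem_points_mulGroup_iff] at hz ⊢
    simp only [Matrix.cons_val_zero, Matrix.cons_val_one, map_pow, eval_X]
    rw [← mul_pow, mul_comm, hz, one_pow]
  have hpull : formPullback (![X 1 ^ n, X 0 ^ n] : Fin 2 → MvPolynomial (Fin 2) ℂ) ![X 1, 0] =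
      ![0, X 0 ^ n * ((n : MvPolynomial (Fin 2) ℂ) * X 1 ^ (n - 1))] := by
    funext i
    fin_cases i
    · simp [formPullback, Fin.sum_univ_two]
    · simp [formPullback, Fin.sum_univ_two]
  have hωalg : ∀ i, HasAlgCoeffs (formPullback (![X 1 ^ n, X 0 ^ n] :
      Fin 2 → MvPolynomial (Fin 2) ℂ) ![X 1, 0] i) := by
    intro i
    rw [hpull]
    fin_cases i
    · simpa using (hasAlgCoeffs_zero (n := 2))
    · simpa using ((hasAlgCoeffs_X (n := 2) 0).pow n).mul
        ((hasAlgCoeffs_natCast n).mul ((hasAlgCoeffs_X (n := 2) 1).pow (n - 1)))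
  have hnalg : ∀ i, HasAlgCoeffs (((((-(n : ℤ) : ℤ) : ℂ)) • (![X 1, 0] :
      Fin 2 → MvPolynomial (Fin 2) ℂ)) i) := fun i => (hasAlgCoeffs_ydx i).smul halg_n
  have hνalg : ∀ i, HasAlgCoeffs ((formPullback (![X 1 ^ n, X 0 ^ n] :
      Fin 2 → MvPolynomial (Fin 2) ℂ) ![X 1, 0] - ((-(n : ℤ) : ℤ) : ℂ) • (![X 1, 0] :
      Fin 2 → MvPolynomial (Fin 2) ℂ)) i) := fun i => (hωalg i).sub (hnalg i)
  have hνvan : VanishesOn ⟨2, 1, ![X 0 * X 1 - 1]⟩ (formPullback (![X 1 ^ n, X 0 ^ n] :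
      Fin 2 → MvPolynomial (Fin 2) ℂ) ![X 1, 0] - ((-(n : ℤ) : ℤ) : ℂ) • (![X 1, 0] :
      Fin 2 → MvPolynomial (Fin 2) ℂ)) := by
    intro z hz v hv
    rw [mem_points_mulGroup_iff] at hz
    rw [mem_tangentSpace_mulGroup_iff] at hv
    rw [hpull, Fin.sum_univ_two]
    simp only [Pi.sub_apply, Pi.smul_apply, Matrix.cons_val_zero, Matrix.cons_val_one,
      map_mul, map_pow, eval_X, map_natCast, smul_eq_C_mul,
      mul_zero, sub_zero, zero_sub, Int.cast_neg, Int.cast_natCast, map_neg, neg_mul, neg_neg]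
    rcases n with _ | k
    · simp
    · have hk : z 0 ^ (k + 1) * (((k + 1 : ℕ) : ℂ) * z 1 ^ (k + 1 - 1)) =
          ((k + 1 : ℕ) : ℂ) * z 0 * (z 0 * z 1) ^ k := by
        rw [Nat.add_sub_cancel]; ring
      rw [hk, hz, one_pow, mul_one]
      linear_combination (((k + 1 : ℕ) : ℂ)) * hv
  -- the four elementary relations
  have key₁ := IsElementaryRelation.pushforward _ _ hG hG (![X 1 ^ n, X 0 ^ n]) hh hhZ ![X 1, 0]
    hasAlgCoeffs_ydx _ hωalg rfl Λ₁ Λm (fun t _ => by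
      rw [hΛm, hΛ₁]
      funext j
      fin_cases j
      · simp only [one_mul, inv_one, Int.cast_one, Int.cast_neg, Int.cast_natCast]
        simp
        rw [← exp_nat_mul]
        congr 1
        ring
      · simp only [one_mul, inv_one, Int.cast_one, Int.cast_neg, Int.cast_natCast]
        simp
        rw [← exp_nat_mul]
        congr 1
        ring)
  have key₂ := IsElementaryRelation.add _ hG Λ₁ _ _ _ hωalg hnalg hνalg
    (add_sub_cancel (((-(n : ℤ) : ℤ) : ℂ) • (![X 1, 0] : Fin 2 → MvPolynomial (Fin 2) ℂ))
      (formPullback (![X 1 ^ n, X 0 ^ n] : Fin 2 → MvPolynomial (Fin 2) ℂ) ![X 1, 0])).symm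
  have key₃ := IsElementaryRelation.smul _ hG Λ₁ ((-(n : ℤ) : ℤ) : ℂ) halg_n ![X 1, 0] _
    hasAlgCoeffs_ydx hnalg rfl
  have key₄ := IsElementaryRelation.vanish _ hG Λ₁ _ hνalg hνvan
  obtain ⟨k, ρ, a, hρ, ha, he⟩ := span_sub (span_add (span_add (span_of_rel key₂)
    (span_of_rel key₃)) (span_of_rel key₄)) (span_of_rel key₁)
  exact ⟨k, ρ, a, hρ, ha, by rw [← he]; abel⟩

/-- **Change of winding number**: `(𝔾ₘ, y dx, Λ_{1,w}) − w · (𝔾ₘ, y dx, Λ_{1,1})` lies in the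
`ℚ̄`-span of the elementary relations, for every `w ∈ ℤ`. [folklore] -/
theorem span_stdLoop_intMul (w : ℤ) (Λ₁ Λw : CurvePath (⟨2, 1, ![X 0 * X 1 - 1]⟩ : CurveData))
    (hΛ₁ : ∀ t, Λ₁.toFun t = ![1 * exp (((1 : ℤ) : ℂ) * (2 * π * I) * t),
      1⁻¹ * exp (-(((1 : ℤ) : ℂ) * (2 * π * I) * t))])
    (hΛw : ∀ t, Λw.toFun t = ![1 * exp ((w : ℂ) * (2 * π * I) * t),
      1⁻¹ * exp (-((w : ℂ) * (2 * π * I) * t))]) :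
    ∃ (k : ℕ) (ρ : Fin k → (PeriodSymbol →₀ ℂ)) (a : Fin k → ℂ),
      (∀ l, IsElementaryRelation (ρ l)) ∧ (∀ l, IsAlgebraic ℚ (a l)) ∧
        Finsupp.single (⟨⟨2, 1, ![X 0 * X 1 - 1]⟩, isSmoothAffineCurve_mulGroup, ![X 1, 0],
            hasAlgCoeffs_ydx, Λw⟩ : PeriodSymbol) (1 : ℂ) -
          (w : ℂ) • Finsupp.single (⟨⟨2, 1, ![X 0 * X 1 - 1]⟩, isSmoothAffineCurve_mulGroup,
            ![X 1, 0], hasAlgCoeffs_ydx, Λ₁⟩ : PeriodSymbol) (1 : ℂ) = ∑ l, a l • ρ l := by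
  obtain ⟨n, rfl | rfl⟩ := Int.eq_nat_or_neg w
  · exact span_stdLoop_natMul n Λ₁ Λw hΛ₁ hΛw
  · exact span_stdLoop_negMul n Λ₁ Λw hΛ₁ hΛw

/-- **Every closed `C¹` path on `𝔾ₘ` is (R5)-equivalent to a standard loop** (unconditional
form of `single_loop_eq_single_stdLoop`: the `C¹` logarithm and the winding number `w` are
supplied by `exists_winding_number`). [cite: HuberWustholz2022, §3.3.1 (pp. 42–43)] -/
theorem exists_single_loop_eq_single_stdLoop (ω : Fin 2 → MvPolynomial (Fin 2) ℂ)
    (h : ∀ i, HasAlgCoeffs (ω i)) (γ : CurvePath (⟨2, 1, ![X 0 * X 1 - 1]⟩ : CurveData))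
    (hcl : γ.toFun 1 = γ.toFun 0) :
    ∃ (w : ℤ) (Λ : CurvePath (⟨2, 1, ![X 0 * X 1 - 1]⟩ : CurveData))
      (ρ₁ ρ₂ ρ₃ : PeriodSymbol →₀ ℂ),
      (∀ t, Λ.toFun t = ![γ.toFun 0 0 * exp (w * (2 * π * I) * t),
        (γ.toFun 0 0)⁻¹ * exp (-(w * (2 * π * I) * t))]) ∧
      IsElementaryRelation ρ₁ ∧ IsElementaryRelation ρ₂ ∧ IsElementaryRelation ρ₃ ∧
      Finsupp.single (⟨⟨2, 1, ![X 0 * X 1 - 1]⟩, isSmoothAffineCurve_mulGroup, ω, h, γ⟩ :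
          PeriodSymbol) (1 : ℂ) =
        Finsupp.single (⟨⟨2, 1, ![X 0 * X 1 - 1]⟩, isSmoothAffineCurve_mulGroup, ω, h, Λ⟩ :
          PeriodSymbol) (1 : ℂ) + (2 • ρ₃ - ρ₁ - ρ₂) := by
  have hx : ContDiffOn ℝ 1 (fun t => γ.toFun t 0) (Icc 0 1) := γ.contDiffOn_apply 0
  have hx0 : ∀ t ∈ Icc (0 : ℝ) 1, γ.toFun t 0 ≠ 0 := fun t ht =>
    left_ne_zero_of_mul_eq_one ((mem_points_mulGroup_iff _).1 (γ.mem_points t ht))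
  have hxcl : γ.toFun 0 0 = γ.toFun 1 0 := by rw [hcl]
  obtain ⟨L, w, hLC, _, hLexp, hw⟩ := exists_winding_number zero_lt_one hx hx0 hxcl
  obtain ⟨Λ, ρ₁, ρ₂, ρ₃, hΛ, h₁, h₂, h₃, he⟩ :=
    single_loop_eq_single_stdLoop ω h γ L hLC hLexp w hw
  exact ⟨w, Λ, ρ₁, ρ₂, ρ₃, hΛ, h₁, h₂, h₃, he⟩

/-! ### Reduction of polynomial 1-forms on `𝔾ₘ` to `α · y dx` -/

/-- Forms vanishing on `𝔾ₘ` are stable under sums. [folklore] -/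
theorem VanishesOn.add {Z : CurveData} {ν₁ ν₂ : Fin Z.n → MvPolynomial (Fin Z.n) ℂ}
    (h₁ : VanishesOn Z ν₁) (h₂ : VanishesOn Z ν₂) : VanishesOn Z (ν₁ + ν₂) := by
  intro z hz v hv
  have e : (∑ i, eval z ((ν₁ + ν₂) i) * v i) =
      (∑ i, eval z (ν₁ i) * v i) + ∑ i, eval z (ν₂ i) * v i := by
    rw [← Finset.sum_add_distrib]
    exact Finset.sum_congr rfl fun i _ => by rw [Pi.add_apply, map_add, add_mul]
  rw [e, h₁ z hz v hv, h₂ z hz v hv, add_zero]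

/-- Forms vanishing on `𝔾ₘ` are stable under scalars. [folklore] -/
theorem VanishesOn.smul {Z : CurveData} {ν : Fin Z.n → MvPolynomial (Fin Z.n) ℂ} (c : ℂ)
    (h : VanishesOn Z ν) : VanishesOn Z (c • ν) := by
  intro z hz v hv
  have e : (∑ i, eval z ((c • ν) i) * v i) = c * ∑ i, eval z (ν i) * v i := by
    rw [Finset.mul_sum]
    exact Finset.sum_congr rfl fun i _ => by
      rw [Pi.smul_apply, smul_eq_C_mul, map_mul, eval_C, mul_assoc]
  rw [e, h z hz v hv, mul_zero]

/-- The zero form vanishes. [folklore] -/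
theorem VanishesOn.zero (Z : CurveData) : VanishesOn Z (0 : Fin Z.n → MvPolynomial (Fin Z.n) ℂ) :=
  fun z _ v _ => by simp

/-- A form `g dx` on `𝔾ₘ ⊂ 𝔸²` whose coefficient vanishes at the points of `𝔾ₘ` vanishes on `𝔾ₘ`.
[folklore] -/
theorem vanishesOn_mulGroup_of_eval_eq_zero (g : MvPolynomial (Fin 2) ℂ)
    (hg : ∀ z : Fin 2 → ℂ, z 0 * z 1 = 1 → eval z g = 0) :
    VanishesOn ⟨2, 1, ![X 0 * X 1 - 1]⟩ (![g, 0] : Fin 2 → MvPolynomial (Fin 2) ℂ) := by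
  intro z hz v _
  rw [mem_points_mulGroup_iff] at hz
  simp [Fin.sum_univ_two, hg z hz]

/-- The forms `Q y² dx + Q dy` vanish on the tangent lines `y v₀ + x v₁ = 0` of `𝔾ₘ` (the relation
`dy = −y² dx` on `𝔾ₘ`). [folklore] -/
theorem vanishesOn_mulGroup_dy (Q : MvPolynomial (Fin 2) ℂ) :
    VanishesOn ⟨2, 1, ![X 0 * X 1 - 1]⟩ (![X 1 ^ 2 * Q, Q] : Fin 2 → MvPolynomial (Fin 2) ℂ) := by
  intro z hz v hv
  rw [mem_points_mulGroup_iff] at hz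
  rw [mem_tangentSpace_mulGroup_iff] at hv
  simp only [Fin.sum_univ_two, Matrix.cons_val_zero, Matrix.cons_val_one, map_mul, map_pow,
    eval_X]
  have key : z 1 ^ 2 * v 0 + v 1 = z 1 * (z 1 * v 0 + z 0 * v 1) := by
    linear_combination (-(v 1)) * hz
  linear_combination eval z Q * key + eval z Q * z 1 * hv

/-- The differential of a sum. [folklore] -/
theorem formD_add {n : ℕ} (P Q : MvPolynomial (Fin n) ℂ) : formD (P + Q) = formD P + formD Q := by
  funext i; simp [formD]

/-- The differential of a scalar multiple. [folklore] -/
theorem formD_C_mul {n : ℕ} (c : ℂ) (P : MvPolynomial (Fin n) ℂ) :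
    formD (C c * P) = c • formD P := by
  funext i; simp [formD, smul_eq_C_mul]

/-- The differential of `0`. [folklore] -/
theorem formD_zero {n : ℕ} : formD (0 : MvPolynomial (Fin n) ℂ) = 0 := by
  funext i; simp [formD]

/-- **Reduction of a monomial form `xᵃyᵇ dx` on `𝔾ₘ`**: it equals `α · y dx + dP + ν` with
`α ∈ {0, 1}`, `P` a monomial with rational coefficient and `ν` vanishing on `𝔾ₘ`
(`xᵃyᵇ ≡ x^{a−b}` or `y^{b−a}` on `xy = 1`; `xᵏ dx = d(x^{k+1}/(k+1))`;
`yᵐ dx = d(−y^{m−1}/(m−1)) + (yᵐ dx + y^{m−2} dy)` for `m ≥ 2`; `y dx` stays). [folklore] -/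
theorem exists_reduction_monomial (a b : ℕ) :
    ∃ (α : ℂ) (P : MvPolynomial (Fin 2) ℂ) (ν : Fin 2 → MvPolynomial (Fin 2) ℂ),
      IsAlgebraic ℚ α ∧ HasAlgCoeffs P ∧ (∀ i, HasAlgCoeffs (ν i)) ∧
        VanishesOn ⟨2, 1, ![X 0 * X 1 - 1]⟩ ν ∧
        (![X 0 ^ a * X 1 ^ b, 0] : Fin 2 → MvPolynomial (Fin 2) ℂ) =
          α • ![X 1, 0] + formD P + ν := by
  rcases le_or_gt b a with hab | hab
  · -- `xᵃyᵇ ≡ xᵏ`, `k = a − b`: exact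
    obtain ⟨k, rfl⟩ := Nat.exists_eq_add_of_le hab
    refine ⟨0, C (1 / ((k : ℂ) + 1)) * X 0 ^ (k + 1),
      ![X 0 ^ (b + k) * X 1 ^ b - X 0 ^ k, 0], isAlgebraic_zero,
      (hasAlgCoeffs_C ?_).mul ((hasAlgCoeffs_X 0).pow _), ?_, ?_, ?_⟩
    · rw [one_div]
      exact (by exact_mod_cast isAlgebraic_nat (R := ℚ) (A := ℂ) (k + 1) :
        IsAlgebraic ℚ ((k : ℂ) + 1)).inv
    · intro i
      fin_cases i
      · simpa using (((hasAlgCoeffs_X (n := 2) 0).pow (b + k)).mul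
          ((hasAlgCoeffs_X (n := 2) 1).pow b)).sub ((hasAlgCoeffs_X (n := 2) 0).pow k)
      · simpa using (hasAlgCoeffs_zero (n := 2))
    · refine vanishesOn_mulGroup_of_eval_eq_zero _ fun z hz => ?_
      simp only [map_sub, map_mul, map_pow, eval_X]
      have e : z 0 ^ (b + k) * z 1 ^ b - z 0 ^ k = z 0 ^ k * (z 0 * z 1) ^ b - z 0 ^ k := by ring
      rw [e, hz, one_pow, mul_one, sub_self]
    · have hk1 : ((k : ℂ) + 1) ≠ 0 := by exact_mod_cast Nat.succ_ne_zero k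
      funext i
      fin_cases i
      · simp [formD]
        rw [show ((k : MvPolynomial (Fin 2) ℂ) + 1) = C ((k : ℂ) + 1) by
          rw [map_add, map_one, map_natCast], ← mul_assoc, ← C_mul, inv_mul_cancel₀ hk1, C_1,
          one_mul]
        ring
      · simp [formD]
  · -- `xᵃyᵇ ≡ yᵐ`, `m = b − a ≥ 1`
    obtain ⟨m, rfl⟩ := Nat.exists_eq_add_of_lt hab
    -- here `b = a + m + 1`, i.e. the reduced exponent is `m + 1`
    rcases Nat.eq_zero_or_pos m with rfl | hm
    · -- `y dx` itself
      refine ⟨1, 0, ![X 0 ^ a * X 1 ^ (a + 0 + 1) - X 1, 0], isAlgebraic_one, hasAlgCoeffs_zero,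
        ?_, ?_, ?_⟩
      · intro i
        fin_cases i
        · simpa using (((hasAlgCoeffs_X (n := 2) 0).pow a).mul
            ((hasAlgCoeffs_X (n := 2) 1).pow (a + 0 + 1))).sub (hasAlgCoeffs_X (n := 2) 1)
        · simpa using (hasAlgCoeffs_zero (n := 2))
      · refine vanishesOn_mulGroup_of_eval_eq_zero _ fun z hz => ?_
        simp only [map_sub, map_mul, map_pow, eval_X, add_zero]
        rw [pow_succ, ← mul_assoc, ← mul_pow, hz, one_pow, one_mul, sub_self]
      · rw [formD_zero, add_zero, one_smul]
        funext i
        fin_cases i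
        · simp
        · simp
    · -- `yᵐ⁺¹ dx` with `m + 1 ≥ 2`
      obtain ⟨j, rfl⟩ := Nat.exists_eq_add_of_le hm
      -- reduced exponent `j + 2`; primitive `−y^{j+1}/(j+1)`
      refine ⟨0, C (-(1 / ((j : ℂ) + 1))) * X 1 ^ (j + 1),
        ![X 0 ^ a * X 1 ^ (a + (1 + j) + 1) - X 1 ^ (j + 2), 0] + ![X 1 ^ 2 * X 1 ^ j, X 1 ^ j],
        isAlgebraic_zero, (hasAlgCoeffs_C ?_).mul ((hasAlgCoeffs_X 1).pow _), ?_, ?_, ?_⟩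
      · rw [one_div]
        exact (by exact_mod_cast isAlgebraic_nat (R := ℚ) (A := ℂ) (j + 1) :
          IsAlgebraic ℚ ((j : ℂ) + 1)).inv.neg
      · intro i
        fin_cases i
        · simpa using ((((hasAlgCoeffs_X (n := 2) 0).pow a).mul
            ((hasAlgCoeffs_X (n := 2) 1).pow (a + (1 + j) + 1))).sub
            ((hasAlgCoeffs_X (n := 2) 1).pow (j + 2))).add
            (((hasAlgCoeffs_X (n := 2) 1).pow 2).mul ((hasAlgCoeffs_X (n := 2) 1).pow j))
        · simpa using (hasAlgCoeffs_X (n := 2) 1).pow j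
      · refine (vanishesOn_mulGroup_of_eval_eq_zero _ fun z hz => ?_).add
          (vanishesOn_mulGroup_dy _)
        simp only [map_sub, map_mul, map_pow, eval_X]
        have e : z 0 ^ a * z 1 ^ (a + (1 + j) + 1) - z 1 ^ (j + 2) =
            z 1 ^ (j + 2) * (z 0 * z 1) ^ a - z 1 ^ (j + 2) := by ring
        rw [e, hz, one_pow, mul_one, sub_self]
      · have hj1 : ((j : ℂ) + 1) ≠ 0 := by exact_mod_cast Nat.succ_ne_zero j
        funext i
        fin_cases i
        · simp [formD]
          ring
        · simp [formD]
          rw [show ((j : MvPolynomial (Fin 2) ℂ) + 1) = C ((j : ℂ) + 1) by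
            rw [map_add, map_one, map_natCast], ← mul_assoc, ← C_mul, inv_mul_cancel₀ hj1, C_1,
            one_mul, neg_add_cancel]

/-- Partial derivatives preserve algebraic coefficients. [folklore] -/
theorem HasAlgCoeffs.pderiv {n : ℕ} {P : MvPolynomial (Fin n) ℂ} (hP : HasAlgCoeffs P) (i : Fin n) :
    HasAlgCoeffs (pderiv i P) := by
  classical
  intro e
  rw [as_sum P, map_sum, coeff_sum]
  refine Finset.sum_induction _ (IsAlgebraic ℚ) (fun _ _ ha hb => ha.add hb) isAlgebraic_zero
    fun d _ => ?_
  rw [pderiv_monomial, coeff_monomial]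
  split_ifs
  · exact (hP d).mul (isAlgebraic_nat _)
  · exact isAlgebraic_zero

/-- The differential of a polynomial over `ℚ̄` has algebraic coefficients. [folklore] -/
theorem HasAlgCoeffs.formD {n : ℕ} {P : MvPolynomial (Fin n) ℂ} (hP : HasAlgCoeffs P) :
    ∀ i, HasAlgCoeffs (formD P i) := fun i => hP.pderiv i

/-- Reduction of `c · xᵃyᵇ dx` for an algebraic scalar `c`. [folklore] -/
theorem exists_reduction_C_mul_monomial {c : ℂ} (hc : IsAlgebraic ℚ c) (a b : ℕ) :
    ∃ (α : ℂ) (P : MvPolynomial (Fin 2) ℂ) (ν : Fin 2 → MvPolynomial (Fin 2) ℂ),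
      IsAlgebraic ℚ α ∧ HasAlgCoeffs P ∧ (∀ i, HasAlgCoeffs (ν i)) ∧
        VanishesOn ⟨2, 1, ![X 0 * X 1 - 1]⟩ ν ∧
        (![C c * (X 0 ^ a * X 1 ^ b), 0] : Fin 2 → MvPolynomial (Fin 2) ℂ) =
          α • ![X 1, 0] + formD P + ν := by
  obtain ⟨α, P, ν, hα, hP, hν, hv, he⟩ := exists_reduction_monomial a b
  refine ⟨c * α, C c * P, c • ν, hc.mul hα, (hasAlgCoeffs_C hc).mul hP,
    fun i => (hν i).smul hc, hv.smul c, ?_⟩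
  have hvec : (![C c * (X 0 ^ a * X 1 ^ b), 0] : Fin 2 → MvPolynomial (Fin 2) ℂ) =
      c • (![X 0 ^ a * X 1 ^ b, 0] : Fin 2 → MvPolynomial (Fin 2) ℂ) := by
    funext i
    fin_cases i
    · simp [smul_eq_C_mul]
    · simp
  rw [hvec, he, formD_C_mul, smul_add, smul_add, smul_smul]

/-- **Reduction of `g dx` on `𝔾ₘ`** for `g ∈ ℚ̄[x, y]`: `g dx = α · y dx + dP + ν` with `α ∈ ℚ̄`,
`P ∈ ℚ̄[x, y]` and `ν` vanishing on `𝔾ₘ` (the coefficient `α` is the residue, i.e. the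
coefficient of `y = x⁻¹` in the Laurent expansion of `g|_{𝔾ₘ}`). [folklore] -/
theorem exists_reduction_dx (g : MvPolynomial (Fin 2) ℂ) (hg : HasAlgCoeffs g) :
    ∃ (α : ℂ) (P : MvPolynomial (Fin 2) ℂ) (ν : Fin 2 → MvPolynomial (Fin 2) ℂ),
      IsAlgebraic ℚ α ∧ HasAlgCoeffs P ∧ (∀ i, HasAlgCoeffs (ν i)) ∧
        VanishesOn ⟨2, 1, ![X 0 * X 1 - 1]⟩ ν ∧
        (![g, 0] : Fin 2 → MvPolynomial (Fin 2) ℂ) = α • ![X 1, 0] + formD P + ν := by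
  classical
  have key : ∀ S : Finset (Fin 2 →₀ ℕ),
      ∃ (α : ℂ) (P : MvPolynomial (Fin 2) ℂ) (ν : Fin 2 → MvPolynomial (Fin 2) ℂ),
        IsAlgebraic ℚ α ∧ HasAlgCoeffs P ∧ (∀ i, HasAlgCoeffs (ν i)) ∧
          VanishesOn ⟨2, 1, ![X 0 * X 1 - 1]⟩ ν ∧
          (![∑ d ∈ S, monomial d (coeff d g), 0] : Fin 2 → MvPolynomial (Fin 2) ℂ) =
            α • ![X 1, 0] + formD P + ν := by
    intro S
    induction S using Finset.induction_on with
    | empty =>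
      refine ⟨0, 0, 0, isAlgebraic_zero, hasAlgCoeffs_zero, fun i => ?_, VanishesOn.zero _, ?_⟩
      · simpa using (hasAlgCoeffs_zero (n := 2))
      · rw [formD_zero, zero_smul, add_zero, add_zero]
        funext i
        fin_cases i <;> simp
    | insert d S hd ih =>
      obtain ⟨α₁, P₁, ν₁, hα₁, hP₁, hν₁, hv₁, he₁⟩ :=
        exists_reduction_C_mul_monomial (hg d) (d 0) (d 1)
      obtain ⟨α₂, P₂, ν₂, hα₂, hP₂, hν₂, hv₂, he₂⟩ := ih
      refine ⟨α₁ + α₂, P₁ + P₂, ν₁ + ν₂, hα₁.add hα₂, hP₁.add hP₂,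
        fun i => (hν₁ i).add (hν₂ i), hv₁.add hv₂, ?_⟩
      have hm : monomial d (coeff d g) = C (coeff d g) * (X 0 ^ d 0 * X 1 ^ d 1) := by
        rw [monomial_eq, Finsupp.prod_pow, Fin.prod_univ_two]
      have hvec : (![∑ x ∈ insert d S, monomial x (coeff x g), 0] :
          Fin 2 → MvPolynomial (Fin 2) ℂ) =
          (![C (coeff d g) * (X 0 ^ d 0 * X 1 ^ d 1), 0] : Fin 2 → MvPolynomial (Fin 2) ℂ) +
            ![∑ x ∈ S, monomial x (coeff x g), 0] := by
        rw [Finset.sum_insert hd, hm]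
        funext i
        fin_cases i <;> simp
      rw [hvec, he₁, he₂, formD_add, add_smul]
      abel
  obtain ⟨α, P, ν, hα, hP, hν, hv, he⟩ := key g.support
  rw [← as_sum g] at he
  exact ⟨α, P, ν, hα, hP, hν, hv, he⟩

/-- **Reduction of a polynomial 1-form on `𝔾ₘ`**: `ω₀ dx + ω₁ dy = α · y dx + dP + ν` with
`α ∈ ℚ̄`, `P ∈ ℚ̄[x, y]`, `ν` vanishing on `𝔾ₘ` (first `dy ≡ −y² dx`, then `exists_reduction_dx`).
In the book's language: `H¹_dR(𝔾ₘ)` is one-dimensional, spanned by `dx/x`. [folklore] -/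
theorem exists_reduction_form (ω : Fin 2 → MvPolynomial (Fin 2) ℂ) (h : ∀ i, HasAlgCoeffs (ω i)) :
    ∃ (α : ℂ) (P : MvPolynomial (Fin 2) ℂ) (ν : Fin 2 → MvPolynomial (Fin 2) ℂ),
      IsAlgebraic ℚ α ∧ HasAlgCoeffs P ∧ (∀ i, HasAlgCoeffs (ν i)) ∧
        VanishesOn ⟨2, 1, ![X 0 * X 1 - 1]⟩ ν ∧ ω = α • ![X 1, 0] + formD P + ν := by
  obtain ⟨α, P, ν, hα, hP, hν, hv, he⟩ := exists_reduction_dx (ω 0 - X 1 ^ 2 * ω 1)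
    ((h 0).sub (((hasAlgCoeffs_X 1).pow 2).mul (h 1)))
  refine ⟨α, P, ν + ![X 1 ^ 2 * ω 1, ω 1], hα, hP, fun i => ?_,
    hv.add (vanishesOn_mulGroup_dy (ω 1)), ?_⟩
  · fin_cases i
    · simpa using (hν 0).add (((hasAlgCoeffs_X (n := 2) 1).pow 2).mul (h 1))
    · simpa using (hν 1).add (h 1)
  · have hω : ω = (![ω 0 - X 1 ^ 2 * ω 1, 0] : Fin 2 → MvPolynomial (Fin 2) ℂ) +
        ![X 1 ^ 2 * ω 1, ω 1] := by
      funext i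
      fin_cases i <;> simp
    calc ω = (![ω 0 - X 1 ^ 2 * ω 1, 0] : Fin 2 → MvPolynomial (Fin 2) ℂ) +
        ![X 1 ^ 2 * ω 1, ω 1] := hω
      _ = α • ![X 1, 0] + formD P + ν + ![X 1 ^ 2 * ω 1, ω 1] := by rw [he]
      _ = α • ![X 1, 0] + formD P + (ν + ![X 1 ^ 2 * ω 1, ω 1]) := by abel

/-- **Closed paths see only the residue**: for a closed `C¹` path `γ` on `𝔾ₘ` and a polynomial
1-form `ω` over `ℚ̄` with residue `α = α(ω)`, `(𝔾ₘ, ω, γ) − α · (𝔾ₘ, y dx, γ)` lies in the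
`ℚ̄`-span of the elementary relations ((R1) twice, (R1b), (R3) with `P(γ(1)) = P(γ(0))`, (R2)).
[folklore] -/
theorem span_single_sub_smul_ydx (ω : Fin 2 → MvPolynomial (Fin 2) ℂ)
    (h : ∀ i, HasAlgCoeffs (ω i)) (γ : CurvePath (⟨2, 1, ![X 0 * X 1 - 1]⟩ : CurveData))
    (hcl : γ.toFun 1 = γ.toFun 0) :
    ∃ α : ℂ, IsAlgebraic ℚ α ∧
      ∃ (k : ℕ) (ρ : Fin k → (PeriodSymbol →₀ ℂ)) (a : Fin k → ℂ),
        (∀ l, IsElementaryRelation (ρ l)) ∧ (∀ l, IsAlgebraic ℚ (a l)) ∧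
          Finsupp.single (⟨⟨2, 1, ![X 0 * X 1 - 1]⟩, isSmoothAffineCurve_mulGroup, ω, h, γ⟩ :
              PeriodSymbol) (1 : ℂ) -
            α • Finsupp.single (⟨⟨2, 1, ![X 0 * X 1 - 1]⟩, isSmoothAffineCurve_mulGroup,
              ![X 1, 0], hasAlgCoeffs_ydx, γ⟩ : PeriodSymbol) (1 : ℂ) = ∑ l, a l • ρ l := by
  have hG := isSmoothAffineCurve_mulGroup
  obtain ⟨α, P, ν, hα, hP, hν, hv, he⟩ := exists_reduction_form ω h
  refine ⟨α, hα, ?_⟩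
  have hαy : ∀ i, HasAlgCoeffs ((α • (![X 1, 0] : Fin 2 → MvPolynomial (Fin 2) ℂ)) i) :=
    fun i => (hasAlgCoeffs_ydx i).smul hα
  have hdP : ∀ i, HasAlgCoeffs (formD P i) := hP.formD
  have h₂alg : ∀ i, HasAlgCoeffs ((α • (![X 1, 0] : Fin 2 → MvPolynomial (Fin 2) ℂ) +
      formD P) i) := fun i => (hαy i).add (hdP i)
  have h₃alg : ∀ i, HasAlgCoeffs ((α • (![X 1, 0] : Fin 2 → MvPolynomial (Fin 2) ℂ) +
      formD P + ν) i) := fun i => (h₂alg i).add (hν i)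
  have r₁ := IsElementaryRelation.add _ hG γ _ _ _ h₃alg h₂alg hν rfl
  have r₂ := IsElementaryRelation.add _ hG γ _ _ _ h₂alg hαy hdP rfl
  have r₃ := IsElementaryRelation.smul _ hG γ α hα ![X 1, 0] _ hasAlgCoeffs_ydx hαy rfl
  have r₄ := IsElementaryRelation.exact _ hG γ P hP _ hdP rfl
  rw [hcl, sub_self, zero_smul, sub_zero] at r₄
  have r₅ := IsElementaryRelation.vanish _ hG γ ν hν hv
  obtain ⟨k, ρ, a, hρ, ha, hsum⟩ := span_add (span_add (span_add (span_add (span_of_rel r₁)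
    (span_of_rel r₂)) (span_of_rel r₃)) (span_of_rel r₄)) (span_of_rel r₅)
  refine ⟨k, ρ, a, hρ, ha, ?_⟩
  rw [PeriodSymbol.mk_eq_mk hG h h₃alg γ he, ← hsum]
  abel

/-! ### Huber–Wüstholz 13.3 (2) for closed paths on `𝔾ₘ` -/

/-- **Every closed-path symbol on `𝔾ₘ` is an algebraic multiple of the standard symbol
`σ = (𝔾ₘ, y dx, Λ_{1,1})` modulo the elementary relations.** [folklore] -/
theorem exists_rel_of_mulGroup_closed (s : PeriodSymbol)
    (hs : s.Z = (⟨2, 1, ![X 0 * X 1 - 1]⟩ : CurveData)) (hcl : s.γ.toFun 1 = s.γ.toFun 0)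
    (Λ₁ : CurvePath (⟨2, 1, ![X 0 * X 1 - 1]⟩ : CurveData))
    (hΛ₁ : ∀ t, Λ₁.toFun t = ![1 * exp (((1 : ℤ) : ℂ) * (2 * π * I) * t),
      1⁻¹ * exp (-(((1 : ℤ) : ℂ) * (2 * π * I) * t))]) :
    ∃ q : ℂ, IsAlgebraic ℚ q ∧
      ∃ (k : ℕ) (ρ : Fin k → (PeriodSymbol →₀ ℂ)) (a : Fin k → ℂ),
        (∀ l, IsElementaryRelation (ρ l)) ∧ (∀ l, IsAlgebraic ℚ (a l)) ∧
          Finsupp.single s (1 : ℂ) -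
            q • Finsupp.single (⟨⟨2, 1, ![X 0 * X 1 - 1]⟩, isSmoothAffineCurve_mulGroup,
              ![X 1, 0], hasAlgCoeffs_ydx, Λ₁⟩ : PeriodSymbol) (1 : ℂ) = ∑ l, a l • ρ l := by
  obtain ⟨Z, hZ, ω, hω, γ⟩ := s
  dsimp only at hs hcl
  subst hs
  have hG := isSmoothAffineCurve_mulGroup
  -- (1) reduce the form to its residue
  obtain ⟨α, hα, h₁⟩ := span_single_sub_smul_ydx ω hω γ hcl
  -- (2) replace the closed path by a standard loop
  obtain ⟨w, Λ, ρ₁, ρ₂, ρ₃, hΛ, hr₁, hr₂, hr₃, he⟩ :=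
    exists_single_loop_eq_single_stdLoop ![X 1, 0] hasAlgCoeffs_ydx γ hcl
  -- (3) move the base point to `1`
  have hp : IsAlgebraic ℚ (γ.toFun 0 0) := γ.algebraic_zero 0
  have hp0 : γ.toFun 0 0 ≠ 0 := left_ne_zero_of_mul_eq_one
    ((mem_points_mulGroup_iff _).1 (γ.mem_points 0 ⟨le_rfl, zero_le_one⟩))
  obtain ⟨Λw, hΛw⟩ := exists_stdLoop isAlgebraic_one one_ne_zero w
  have h₃ := rel_stdLoop_baseChange hp hp0 w Λ Λw hΛ hΛw
  -- (4) reduce the winding number to `1`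
  have h₄ := span_stdLoop_intMul w Λ₁ Λw hΛ₁ hΛw
  -- combine
  refine ⟨α * w, hα.mul (isAlgebraic_int w), ?_⟩
  have h₂ : ∃ (k : ℕ) (ρ : Fin k → (PeriodSymbol →₀ ℂ)) (a : Fin k → ℂ),
      (∀ l, IsElementaryRelation (ρ l)) ∧ (∀ l, IsAlgebraic ℚ (a l)) ∧
        Finsupp.single (⟨⟨2, 1, ![X 0 * X 1 - 1]⟩, hG, ![X 1, 0], hasAlgCoeffs_ydx, γ⟩ :
            PeriodSymbol) (1 : ℂ) -
          Finsupp.single (⟨⟨2, 1, ![X 0 * X 1 - 1]⟩, hG, ![X 1, 0], hasAlgCoeffs_ydx, Λ⟩ :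
            PeriodSymbol) (1 : ℂ) = ∑ l, a l • ρ l := by
    obtain ⟨k, ρ, a, hρ, ha, hsum⟩ := span_sub (span_sub
      (span_smul (by exact_mod_cast isAlgebraic_nat (R := ℚ) (A := ℂ) 2 : IsAlgebraic ℚ (2 : ℂ))
        (span_of_rel hr₃)) (span_of_rel hr₁)) (span_of_rel hr₂)
    refine ⟨k, ρ, a, hρ, ha, ?_⟩
    rw [he, ← hsum, two_smul, two_smul]
    abel
  obtain ⟨k, ρ, a, hρ, ha, hsum⟩ :=
    span_add h₁ (span_smul hα (span_add (span_add h₂ (span_of_rel h₃)) h₄))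
  refine ⟨k, ρ, a, hρ, ha, ?_⟩
  rw [← hsum, mul_smul, smul_add, smul_add, smul_sub, smul_sub, smul_sub, smul_smul]
  abel

/-- **Huber–Wüstholz, Theorem 13.3 (2), for closed paths on `𝔾ₘ`** (toy case of the named fact
`HuberWustholzCurvePeriods`, proved; no transcendence input): a vanishing `ℚ̄`-linear combination
of period symbols `(𝔾ₘ, ω, γ)` with `γ` closed is a `ℚ̄`-linear combination of elementary
relations. Indeed every such symbol is `q_s · σ` modulo relations with `q_s ∈ ℚ̄`
(`exists_rel_of_mulGroup_closed`), `∫_σ y dx = 2πi ≠ 0`, so by the (proved) soundness of the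
relations `Σ c_s ∫ = 2πi Σ c_s q_s = 0` forces `Σ c_s q_s = 0`.
[cite: HuberWustholz2022, Thm. 13.3 (2) (p. 121), §10.1 (p. 96)] -/
theorem huberWustholzCurvePeriods_of_mulGroup_closed (c : PeriodSymbol →₀ ℂ)
    (hc : ∀ s, IsAlgebraic ℚ (c s))
    (hsupp : ∀ s ∈ c.support, s.Z = (⟨2, 1, ![X 0 * X 1 - 1]⟩ : CurveData) ∧
      s.γ.toFun 1 = s.γ.toFun 0)
    (h0 : evalCombination c = 0) :
    ∃ (k : ℕ) (ρ : Fin k → (PeriodSymbol →₀ ℂ)) (a : Fin k → ℂ),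
      (∀ l, IsElementaryRelation (ρ l)) ∧ (∀ l, IsAlgebraic ℚ (a l)) ∧ c = ∑ l, a l • ρ l := by
  classical
  obtain ⟨Λ₁, hΛ₁⟩ := exists_stdLoop (p := (1 : ℂ)) isAlgebraic_one one_ne_zero (1 : ℤ)
  have hσper : (⟨⟨2, 1, ![X 0 * X 1 - 1]⟩, isSmoothAffineCurve_mulGroup, ![X 1, 0],
      hasAlgCoeffs_ydx, Λ₁⟩ : PeriodSymbol).period = 2 * π * I := by
    have h := period_ydx_stdLoop one_ne_zero 1 Λ₁ hΛ₁
    simpa using h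
  have key : ∀ s : PeriodSymbol, ∃ q : ℂ, s ∈ c.support → (IsAlgebraic ℚ q ∧
      ∃ (k : ℕ) (ρ : Fin k → (PeriodSymbol →₀ ℂ)) (a : Fin k → ℂ),
        (∀ l, IsElementaryRelation (ρ l)) ∧ (∀ l, IsAlgebraic ℚ (a l)) ∧
          Finsupp.single s (1 : ℂ) -
            q • Finsupp.single (⟨⟨2, 1, ![X 0 * X 1 - 1]⟩, isSmoothAffineCurve_mulGroup,
              ![X 1, 0], hasAlgCoeffs_ydx, Λ₁⟩ : PeriodSymbol) (1 : ℂ) = ∑ l, a l • ρ l) := by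
    intro s
    by_cases hs : s ∈ c.support
    · obtain ⟨q, hq, hsp⟩ := exists_rel_of_mulGroup_closed s (hsupp s hs).1 (hsupp s hs).2 Λ₁ hΛ₁
      exact ⟨q, fun _ => ⟨hq, hsp⟩⟩
    · exact ⟨0, fun h => (hs h).elim⟩
  choose q hq using key
  -- soundness: the period of `s` is `q_s · 2πi`
  have hper : ∀ s ∈ c.support, s.period = q s * (2 * π * I) := by
    intro s hs
    obtain ⟨k, ρ, a, hρ, _, he⟩ := (hq s hs).2
    have h1 := evalCombination_eq_zero_of_isElementaryRelation ρ a hρ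
    rw [← he, sub_eq_add_neg, evalCombination_add, ← neg_smul, evalCombination_smul,
      evalCombination_single, evalCombination_single, hσper] at h1
    linear_combination h1
  -- hence `Σ c_s q_s = 0`
  have hev : ∑ s ∈ c.support, c s * q s = 0 := by
    have h2 : (∑ s ∈ c.support, c s * q s) * (2 * π * I) = 0 := by
      rw [Finset.sum_mul, ← h0, evalCombination, Finsupp.sum]
      exact Finset.sum_congr rfl fun s hs => by rw [hper s hs, mul_assoc]
    exact (mul_eq_zero.1 h2).resolve_right two_pi_I_ne_zero
  -- `c = Σ c_s · (s − q_s σ)`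
  have hc_eq : c = ∑ s ∈ c.support, c s • Finsupp.single s (1 : ℂ) := by
    conv_lhs => rw [← Finsupp.sum_single c]
    simp only [Finsupp.sum, Finsupp.smul_single_one]
  have hdec : c = ∑ s ∈ c.support, c s • (Finsupp.single s (1 : ℂ) -
      q s • Finsupp.single (⟨⟨2, 1, ![X 0 * X 1 - 1]⟩, isSmoothAffineCurve_mulGroup,
        ![X 1, 0], hasAlgCoeffs_ydx, Λ₁⟩ : PeriodSymbol) (1 : ℂ)) := by
    have hsplit : ∑ s ∈ c.support, c s • (Finsupp.single s (1 : ℂ) -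
        q s • Finsupp.single (⟨⟨2, 1, ![X 0 * X 1 - 1]⟩, isSmoothAffineCurve_mulGroup,
          ![X 1, 0], hasAlgCoeffs_ydx, Λ₁⟩ : PeriodSymbol) (1 : ℂ)) =
        ∑ s ∈ c.support, c s • Finsupp.single s (1 : ℂ) -
          (∑ s ∈ c.support, c s * q s) • Finsupp.single (⟨⟨2, 1, ![X 0 * X 1 - 1]⟩,
            isSmoothAffineCurve_mulGroup, ![X 1, 0], hasAlgCoeffs_ydx, Λ₁⟩ : PeriodSymbol)
            (1 : ℂ) := by
      rw [Finset.sum_smul, ← Finset.sum_sub_distrib]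
      exact Finset.sum_congr rfl fun s _ => by rw [smul_sub, smul_smul]
    rw [hsplit, hev, zero_smul, sub_zero]
    exact hc_eq
  -- the span is closed under the finite sum
  have hspan : ∀ S : Finset PeriodSymbol, S ⊆ c.support →
      ∃ (k : ℕ) (ρ : Fin k → (PeriodSymbol →₀ ℂ)) (a : Fin k → ℂ),
        (∀ l, IsElementaryRelation (ρ l)) ∧ (∀ l, IsAlgebraic ℚ (a l)) ∧
          ∑ s ∈ S, c s • (Finsupp.single s (1 : ℂ) -
            q s • Finsupp.single (⟨⟨2, 1, ![X 0 * X 1 - 1]⟩, isSmoothAffineCurve_mulGroup,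
              ![X 1, 0], hasAlgCoeffs_ydx, Λ₁⟩ : PeriodSymbol) (1 : ℂ)) = ∑ l, a l • ρ l := by
    intro S hS
    induction S using Finset.induction_on with
    | empty => simpa using span_zero
    | insert s S hs ih =>
      rw [Finset.sum_insert hs]
      exact span_add (span_smul (hc s) (hq s (hS (Finset.mem_insert_self s S))).2)
        (ih (subset_trans (Finset.subset_insert s S) hS))
  obtain ⟨k, ρ, a, hρ, ha, he⟩ := hspan c.support subset_rfl
  exact ⟨k, ρ, a, hρ, ha, hdec.trans he⟩

end CurvePeriods

end Literature.NumberTheory.Transcendental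

end
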